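import Literature.ComputerArithmetic.Shewchuk1997.Orient2dStageA
import Literature.ComputerArithmetic.Shewchuk1997.FastExpansionSum
import Mathlib.Tactic.Linarith
import Mathlib.Tactic.Positivity
import Mathlib.Tactic.Ring
import Mathlib.Tactic.FieldSimp
import Mathlib.Tactic.NormNum

/-!
# Shewchuk 1997, §4.4: the floating-point filter of INCIRCLE (stage A) and its error bound

J. R. Shewchuk, *Adaptive precision floating-point arithmetic and fast robust geometric predicates*,
Discrete Comput. Geom. 18 (1997) 305–363, §4.2 p. 344–345 (the incircle test; determinant (9),
two-dimensional version: rows `(a_x − d_x, a_y − d_y, (a_x − d_x)² + (a_y − d_y)²)` etc.) and §4.4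
"ORIENT3D, INCIRCLE, and INSPHERE", p. 352: "INCIRCLE is implemented similarly to ORIENT3D, as the
determinants are similar.  The corresponding error bounds appear in Table 5" — Table 5 p. 352,
line A: `(10ε + 96ε²) ⊗ (α_a ⊕ α_b ⊕ α_c)` with
`α_a = ((a_x ⊖ d_x)² ⊕ (a_y ⊖ d_y)²) ⊗ (|(b_x ⊖ d_x) ⊗ (c_y ⊖ d_y)| ⊕ |(b_y ⊖ d_y) ⊗ (c_x ⊖ d_x)|)`
("squares are approximate") and `α_b`, `α_c` cyclically; and the public-domain `predicates.c`
(function `incircle`, constant `iccerrboundA = (10.0 + 96.0 * epsilon) * epsilon`).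

THE RESULT.  INCIRCLE(a, b, c, d) is the sign of
`(adx² + ady²)·(bdx·cdy − cdx·bdy) + (bdx² + bdy²)·(cdx·ady − adx·cdy) + (cdx² + cdy²)·(adx·bdy − bdx·ady)`
(`adx = a_x − d_x`, …; the `3 × 3` determinant (9) expanded along its third column — positive iff
`d` lies inside the circle through `a`, `b`, `c` taken counterclockwise, §4.2 p. 344).  Stage A
evaluates this expression in floating point exactly as ORIENT3D's stage A (Fig. 22 p. 351) with
the three `z`-differences replaced by the three "lifts" `alift = adx ⊗ adx ⊕ ady ⊗ ady`, …,
computes the permanent `α_a ⊕ α_b ⊕ α_c` of Table 5 and `errbound = (10ε + 96ε²) ⊗ permanent`,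
and returns `det` if `|det| > errbound`; otherwise it falls through to `incircleadapt`
(stages B–D).  Table 5, line A asserts that a `det` so returned has the sign of the exact
determinant; the paper prints the bound without its derivation, which is carried out here (the
method of §4.3 p. 348, one level up, with the lift's relative error `(1 + ε)⁴ − 1` in place of the
`ε` of a single difference).

THIS FILE types stage A as `incircleStageA fl K` (`some det` = the filter answers, `none` = fall
through) and proves `incircleStageA_correct`: for `p ≥ 6`, ANY round-to-nearest `fl` (any tie
rule), `K = iccerrboundA p = (10 + 96ε)ε` (`ε = 2^−p`), and input coordinates in a format
`F(p, e₀)` coarse enough that no operation of stage A underflows inexactly (`emin ≤ e₀`,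
`emin + 2p ≤ 4e₀`; binary64: coordinates that are multiples of `2^−242`), whenever stage A
returns `det`, `det > 0 ↔ D > 0` and `det < 0 ↔ D < 0` for the exact determinant `D = incircleDet`.
The heart is the abstract inequality `incircle_stageA_sign_of_bounds`: with relative errors `ε`
w.r.t. the COMPUTED values for the six differences, the six products, the six squares, the three
lift additions and the last addition, and w.r.t. the true operands for the minors, the three
cofactor products, the first addition and the nine operations of the bound, one gets
`|D − det| ≤ ε|det| + (10ε + 24ε² + 36ε³ + 35ε⁴ + 21ε⁵ + 7ε⁶ + ε⁷)·Π` and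
`errbound ≥ (1 − ε)⁵(10ε + 96ε²)·Π` for the exact permanent `Π = Σ lift·(|P| + |P'|)` of the
computed lifts and products, and the margin `(1 − ε)⁶(10 + 96ε)ε − (10ε + 24ε² + … + ε⁷)
= ε²(12 − 462ε + 1205ε² − 1791ε³ + 1373ε⁴ − 567ε⁵ + 96ε⁶)` is positive for `0 < ε ≤ 1/64` —
which is where `p ≥ 6` enters (the leading `10` of Shewchuk's coefficient is exactly the
first-order constant `4 + 3 + 1 + 1 + 1`: lift, minor, cofactor product, two additions).
MODELLING NOTES: (i) as for ORIENT3D, the two three-term sums (of the cofactor terms, and of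
`α_a, α_b, α_c`) are typed left-to-right, `(q_a ⊕ q_b) ⊕ q_c`, as C evaluates `predicates.c`'s
`alift * (bdxcdy - cdxbdy) + blift * (cdxady - adxcdy) + clift * (adxbdy - bdxady)` and its
`permanent`; (ii) the acceptance test is typed strict, `errbound < det ∨ errbound < −det`, as in
`predicates.c` (`(det > errbound) || (-det > errbound)`); the non-strict test is covered by the
same margin; (iii) overflow is not modelled (as everywhere in this library); (iv) Table 5 writes
`α_a = lift ⊗ (|P| ⊕ |P'|)`, `predicates.c` multiplies in the other order — the same operation;
the lifts are sums of two rounded squares and hence nonnegative, so no absolute value is taken.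
-/

namespace Literature.ComputerArithmetic.Shewchuk1997

open Literature.ComputerArithmetic.JeannerodRump2018
open Literature.ComputerArithmetic.BoldoJeannerodMelquiondMuller2023
open Literature.ComputerArithmetic.JeannerodLouvetMuller2013

variable {p : ℕ} {emin : ℤ} {fl : ℚ → ℚ}

/-! ## The error analysis of a lift, of one cofactor term and of the whole determinant -/

/-- **The lift `(a_x ⊖ d_x)² ⊕ (a_y ⊖ d_y)²` of Table 5.**  Let `t_i = x_i ± ε|x_i|` (`i = 1, 2`:
true vs computed differences), `x_i·x_i = S_i ± ε|S_i|` with `S_i ≥ 0` (computed squares) and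
`S₁ + S₂ = L ± ε|L|` with `L ≥ 0` (computed lift).  Then the true lift satisfies
`|(t₁² + t₂²) − L| ≤ (4ε + 6ε² + 4ε³ + ε⁴)·|L| = ((1 + ε)⁴ − 1)·|L|`
(product step of p. 348 for each square: `t_i² = S_i ± (3ε + 3ε² + ε³)S_i`; then one addition).
[cite: Shewchuk1997, §4.3 p. 348 (method); §4.4 Table 5 p. 352] -/
theorem lift_sub_le_of_rel {u t₁ t₂ x₁ x₂ S₁ S₂ L : ℚ} (hu : 0 ≤ u)
    (h₁ : |t₁ - x₁| ≤ u * |x₁|) (h₂ : |t₂ - x₂| ≤ u * |x₂|)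
    (hS₁ : |x₁ * x₁ - S₁| ≤ u * |S₁|) (hS₂ : |x₂ * x₂ - S₂| ≤ u * |S₂|)
    (hS₁0 : 0 ≤ S₁) (hS₂0 : 0 ≤ S₂) (hL : |(S₁ + S₂) - L| ≤ u * |L|) (hL0 : 0 ≤ L) :
    |(t₁ * t₁ + t₂ * t₂) - L| ≤ (4 * u + 6 * u ^ 2 + 4 * u ^ 3 + u ^ 4) * |L| := by
  have e₁ : |t₁ * t₁ - S₁| ≤ (3 * u + 3 * u ^ 2 + u ^ 3) * |S₁| :=
    abs_mul_sub_le_of_rel hu h₁ h₁ hS₁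
  have e₂ : |t₂ * t₂ - S₂| ≤ (3 * u + 3 * u ^ 2 + u ^ 3) * |S₂| :=
    abs_mul_sub_le_of_rel hu h₂ h₂ hS₂
  rw [abs_of_nonneg hS₁0] at e₁
  rw [abs_of_nonneg hS₂0] at e₂
  rw [abs_of_nonneg hL0] at hL ⊢
  have hc : 0 ≤ 3 * u + 3 * u ^ 2 + u ^ 3 := by positivity
  have hsum : S₁ + S₂ ≤ (1 + u) * L := by
    have h := (abs_sub_le_iff.mp hL).1
    linarith
  have hdec : (t₁ * t₁ + t₂ * t₂) - L = (t₁ * t₁ - S₁) + (t₂ * t₂ - S₂) + ((S₁ + S₂) - L) := by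
    ring
  rw [hdec]
  calc |(t₁ * t₁ - S₁) + (t₂ * t₂ - S₂) + ((S₁ + S₂) - L)|
        ≤ |t₁ * t₁ - S₁| + |t₂ * t₂ - S₂| + |(S₁ + S₂) - L| := abs_add_three _ _ _
    _ ≤ (3 * u + 3 * u ^ 2 + u ^ 3) * S₁ + (3 * u + 3 * u ^ 2 + u ^ 3) * S₂ + u * L :=
        add_le_add (add_le_add e₁ e₂) hL
    _ = (3 * u + 3 * u ^ 2 + u ^ 3) * (S₁ + S₂) + u * L := by ring
    _ ≤ (3 * u + 3 * u ^ 2 + u ^ 3) * ((1 + u) * L) + u * L :=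
        add_le_add (mul_le_mul_of_nonneg_left hsum hc) le_rfl
    _ = (4 * u + 6 * u ^ 2 + 4 * u ^ 3 + u ^ 4) * L := by ring

/-- **One cofactor term `lift ⊗ minor`** (the analogue of p. 348 one level up, with an arbitrary
relative error `v` on the first factor).  Let `y₀ = z₀ ± v|z₀|` (the true lift against the
computed one), `y_i = z_i ± ε|z_i|` (`i = 1..4`: the four factors of the minor, true vs computed),
`z₁z₂ = P₁ ± ε|P₁|`, `z₃z₄ = P₂ ± ε|P₂|` (computed products), `P₁ − P₂ = M ± ε|P₁ − P₂|`
(computed minor) and `z₀M = Q ± ε|z₀M|` (computed cofactor term).  Then, with `S = |P₁| + |P₂|`,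
`|y₀(y₁y₂ − y₃y₄) − Q| ≤ (v(1 + 3ε + 3ε² + ε³) + 5ε + 4ε² + ε³)·|z₀|S` and
`|Q| ≤ (1 + ε)²·|z₀|S`.  (With `v = ε` this is the cofactor term of ORIENT3D, constant
`6ε + 7ε² + 4ε³ + ε⁴`; with `v = (1 + ε)⁴ − 1` it is INCIRCLE's,
`9ε + 22ε² + 35ε³ + 35ε⁴ + 21ε⁵ + 7ε⁶ + ε⁷`.)
[cite: Shewchuk1997, §4.3 p. 348 (method); §4.4 p. 352, Table 5] -/
theorem liftedCofactor_sub_le_of_rel {u v y₀ y₁ y₂ y₃ y₄ z₀ z₁ z₂ z₃ z₄ P₁ P₂ M Q : ℚ}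
    (hu : 0 ≤ u) (hv : 0 ≤ v)
    (h₀ : |y₀ - z₀| ≤ v * |z₀|) (h₁ : |y₁ - z₁| ≤ u * |z₁|) (h₂ : |y₂ - z₂| ≤ u * |z₂|)
    (h₃ : |y₃ - z₃| ≤ u * |z₃|) (h₄ : |y₄ - z₄| ≤ u * |z₄|)
    (hP₁ : |z₁ * z₂ - P₁| ≤ u * |P₁|) (hP₂ : |z₃ * z₄ - P₂| ≤ u * |P₂|)
    (hM : |(P₁ - P₂) - M| ≤ u * |P₁ - P₂|) (hQ : |z₀ * M - Q| ≤ u * |z₀ * M|) :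
    |y₀ * (y₁ * y₂ - y₃ * y₄) - Q| ≤
        (v * (1 + 3 * u + 3 * u ^ 2 + u ^ 3) + 5 * u + 4 * u ^ 2 + u ^ 3)
          * (|z₀| * (|P₁| + |P₂|)) ∧
      |Q| ≤ (1 + u) ^ 2 * (|z₀| * (|P₁| + |P₂|)) := by
  have e₁ : |y₁ * y₂ - P₁| ≤ (3 * u + 3 * u ^ 2 + u ^ 3) * |P₁| :=
    abs_mul_sub_le_of_rel hu h₁ h₂ hP₁
  have e₂ : |y₃ * y₄ - P₂| ≤ (3 * u + 3 * u ^ 2 + u ^ 3) * |P₂| :=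
    abs_mul_sub_le_of_rel hu h₃ h₄ hP₂
  have hz0 : 0 ≤ |z₀| := abs_nonneg _
  have hPP : |P₁ - P₂| ≤ |P₁| + |P₂| := abs_sub _ _
  -- the true minor against `P₁ − P₂` and against the computed minor `M`
  have hm1 : |(y₁ * y₂ - y₃ * y₄) - (P₁ - P₂)| ≤ (3 * u + 3 * u ^ 2 + u ^ 3) * (|P₁| + |P₂|) := by
    have hdec : (y₁ * y₂ - y₃ * y₄) - (P₁ - P₂) = (y₁ * y₂ - P₁) - (y₃ * y₄ - P₂) := by ring
    rw [hdec]
    calc |(y₁ * y₂ - P₁) - (y₃ * y₄ - P₂)| ≤ |y₁ * y₂ - P₁| + |y₃ * y₄ - P₂| := abs_sub _ _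
      _ ≤ (3 * u + 3 * u ^ 2 + u ^ 3) * |P₁| + (3 * u + 3 * u ^ 2 + u ^ 3) * |P₂| :=
          add_le_add e₁ e₂
      _ = (3 * u + 3 * u ^ 2 + u ^ 3) * (|P₁| + |P₂|) := by ring
  have hmM : |(y₁ * y₂ - y₃ * y₄) - M| ≤ (4 * u + 3 * u ^ 2 + u ^ 3) * (|P₁| + |P₂|) := by
    have hdec : (y₁ * y₂ - y₃ * y₄) - M = ((y₁ * y₂ - y₃ * y₄) - (P₁ - P₂)) + ((P₁ - P₂) - M) := by
      ring
    rw [hdec]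
    calc |((y₁ * y₂ - y₃ * y₄) - (P₁ - P₂)) + ((P₁ - P₂) - M)|
          ≤ |(y₁ * y₂ - y₃ * y₄) - (P₁ - P₂)| + |(P₁ - P₂) - M| := abs_add_le _ _
      _ ≤ (3 * u + 3 * u ^ 2 + u ^ 3) * (|P₁| + |P₂|) + u * (|P₁| + |P₂|) :=
          add_le_add hm1 (hM.trans (mul_le_mul_of_nonneg_left hPP hu))
      _ = (4 * u + 3 * u ^ 2 + u ^ 3) * (|P₁| + |P₂|) := by ring
  have hm_abs : |y₁ * y₂ - y₃ * y₄| ≤ (1 + 3 * u + 3 * u ^ 2 + u ^ 3) * (|P₁| + |P₂|) := by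
    have := abs_sub_abs_le_abs_sub (y₁ * y₂ - y₃ * y₄) (P₁ - P₂)
    linarith
  have hM_abs : |M| ≤ (1 + u) * (|P₁| + |P₂|) := by
    have h1 := abs_sub_abs_le_abs_sub M (P₁ - P₂)
    rw [abs_sub_comm M (P₁ - P₂)] at h1
    have h2 : u * |P₁ - P₂| ≤ u * (|P₁| + |P₂|) := mul_le_mul_of_nonneg_left hPP hu
    linarith
  have hQ' : |z₀ * M - Q| ≤ u * (|z₀| * |M|) := by rw [← abs_mul]; exact hQ
  have hdec : y₀ * (y₁ * y₂ - y₃ * y₄) - Q =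
      (y₀ - z₀) * (y₁ * y₂ - y₃ * y₄) + z₀ * ((y₁ * y₂ - y₃ * y₄) - M) + (z₀ * M - Q) := by ring
  constructor
  · rw [hdec]
    calc |(y₀ - z₀) * (y₁ * y₂ - y₃ * y₄) + z₀ * ((y₁ * y₂ - y₃ * y₄) - M) + (z₀ * M - Q)|
          ≤ |(y₀ - z₀) * (y₁ * y₂ - y₃ * y₄)| + |z₀ * ((y₁ * y₂ - y₃ * y₄) - M)| + |z₀ * M - Q| :=
          abs_add_three _ _ _
      _ = |y₀ - z₀| * |y₁ * y₂ - y₃ * y₄| + |z₀| * |(y₁ * y₂ - y₃ * y₄) - M| + |z₀ * M - Q| := by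
          rw [abs_mul, abs_mul]
      _ ≤ v * |z₀| * ((1 + 3 * u + 3 * u ^ 2 + u ^ 3) * (|P₁| + |P₂|))
          + |z₀| * ((4 * u + 3 * u ^ 2 + u ^ 3) * (|P₁| + |P₂|))
          + u * (|z₀| * ((1 + u) * (|P₁| + |P₂|))) := by
          refine add_le_add (add_le_add ?_ ?_) ?_
          · exact mul_le_mul h₀ hm_abs (abs_nonneg _) (by positivity)
          · exact mul_le_mul_of_nonneg_left hmM hz0
          · exact hQ'.trans (mul_le_mul_of_nonneg_left (mul_le_mul_of_nonneg_left hM_abs hz0) hu)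
      _ = (v * (1 + 3 * u + 3 * u ^ 2 + u ^ 3) + 5 * u + 4 * u ^ 2 + u ^ 3)
          * (|z₀| * (|P₁| + |P₂|)) := by ring
  · calc |Q| ≤ |z₀ * M| + u * |z₀ * M| := by
          have h1 := abs_sub_abs_le_abs_sub Q (z₀ * M)
          rw [abs_sub_comm Q (z₀ * M)] at h1
          linarith
      _ = (1 + u) * (|z₀| * |M|) := by rw [abs_mul]; ring
      _ ≤ (1 + u) * (|z₀| * ((1 + u) * (|P₁| + |P₂|))) :=
          mul_le_mul_of_nonneg_left (mul_le_mul_of_nonneg_left hM_abs hz0) (by positivity)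
      _ = (1 + u) ^ 2 * (|z₀| * (|P₁| + |P₂|)) := by ring

/-- **The margin of Table 5, line A**: for `0 ≤ ε ≤ 1/64`,
`10ε + 24ε² + 36ε³ + 35ε⁴ + 21ε⁵ + 7ε⁶ + ε⁷ ≤ (1 − ε)⁶(10 + 96ε)ε`, because the difference is
`ε²(12 − 462ε + 1205ε² − 1791ε³ + 1373ε⁴ − 567ε⁵ + 96ε⁶)` and `12 − 462ε ≥ 12 − 462/64 > 0`,
`1205ε² ≥ 1791ε³`, `1373ε⁴ ≥ 567ε⁵`.  (At `ε = 1/32` the margin is already negative,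
`≈ −1.31ε²`: the coefficient `10ε + 96ε²` is tailored to IEEE precisions.)
[cite: Shewchuk1997, §4.4 Table 5 p. 352] -/
theorem iccerrboundA_margin {u : ℚ} (hu0 : 0 ≤ u) (hu : u ≤ 1 / 64) :
    10 * u + 24 * u ^ 2 + 36 * u ^ 3 + 35 * u ^ 4 + 21 * u ^ 5 + 7 * u ^ 6 + u ^ 7
      ≤ (1 - u) ^ 6 * ((10 + 96 * u) * u) := by
  have hkey : (1 - u) ^ 6 * ((10 + 96 * u) * u)
      - (10 * u + 24 * u ^ 2 + 36 * u ^ 3 + 35 * u ^ 4 + 21 * u ^ 5 + 7 * u ^ 6 + u ^ 7) =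
      u ^ 2 * (12 - 462 * u + 1205 * u ^ 2 - 1791 * u ^ 3 + 1373 * u ^ 4 - 567 * u ^ 5
        + 96 * u ^ 6) := by
    ring
  have h1 : 0 ≤ 12 - 462 * u := by linarith
  have h2 : 0 ≤ 1205 * u ^ 2 - 1791 * u ^ 3 := by
    have h : 0 ≤ 1205 - 1791 * u := by linarith
    have := mul_nonneg (pow_nonneg hu0 2) h
    linarith
  have h3 : 0 ≤ 1373 * u ^ 4 - 567 * u ^ 5 := by
    have h : 0 ≤ 1373 - 567 * u := by linarith
    have := mul_nonneg (pow_nonneg hu0 4) h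
    linarith
  have h4 : 0 ≤ 96 * u ^ 6 := by positivity
  have hpoly : 0 ≤ 12 - 462 * u + 1205 * u ^ 2 - 1791 * u ^ 3 + 1373 * u ^ 4 - 567 * u ^ 5
      + 96 * u ^ 6 := by linarith
  have := mul_nonneg (pow_nonneg hu0 2) hpoly
  rw [← hkey] at this
  linarith

set_option maxHeartbeats 400000 in
/-- **The sign test of INCIRCLE's stage A is sound** (Table 5, line A), as an inequality between
rationals.  Let `0 < ε ≤ 1/64` and `K ≥ (10 + 96ε)ε`.  The six differences, six products, six
squares carry relative errors `ε` w.r.t. their COMPUTED values (`t = x ± ε|x|`,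
`x·x' = P ± ε|P|`, `x·x = S ± ε|S|`, `S ≥ 0`), the three lifts `L = fl(S + S') ≥ 0` and the last
addition `det = fl(R + Q_c)` likewise w.r.t. the computed value; the three minors
`M = fl(P − P')`, the three cofactor terms `Q = fl(L·M)` and the first addition
`R = fl(Q_a + Q_b)` relative errors `ε` w.r.t. the true operands; the bound is evaluated as
`A_a = fl(|P₁| + |P₂|)`, `α_a = fl(A_a L_a)` (likewise `b`, `c`), `W₁ = fl(α_a + α_b)`,
`W = fl(W₁ + α_c)`, `E = fl(KW)`, each with relative error `ε`.  If the test `E < |det|` passes,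
then `det` has the sign of the exact determinant (strictly, both ways).  Proof:
`|D − det| ≤ ε|det| + (10ε + 24ε² + 36ε³ + 35ε⁴ + 21ε⁵ + 7ε⁶ + ε⁷)Π` (`lift_sub_le_of_rel` and
`liftedCofactor_sub_le_of_rel` thrice, `Π` the exact permanent of the computed lifts and
products), `E ≥ (1 − ε)⁵KΠ`, and `iccerrboundA_margin`.
[cite: Shewchuk1997, §4.4 Table 5 p. 352 (line A); §4.3 p. 348 (method)] -/
theorem incircle_stageA_sign_of_bounds
    {u K ta₁ ta₂ tb₁ tb₂ tc₁ tc₂ xa₁ xa₂ xb₁ xb₂ xc₁ xc₂ P₁ P₂ P₃ P₄ P₅ P₆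
      Sa₁ Sa₂ Sb₁ Sb₂ Sc₁ Sc₂ La Lb Lc Ma Mb Mc Qa Qb Qc R det Aa Ab Ac αa αb αc W₁ W E : ℚ}
    (hu0 : 0 < u) (hu : u ≤ 1 / 64) (hK : (10 + 96 * u) * u ≤ K)
    (ha₁ : |ta₁ - xa₁| ≤ u * |xa₁|) (ha₂ : |ta₂ - xa₂| ≤ u * |xa₂|)
    (hb₁ : |tb₁ - xb₁| ≤ u * |xb₁|) (hb₂ : |tb₂ - xb₂| ≤ u * |xb₂|)
    (hc₁ : |tc₁ - xc₁| ≤ u * |xc₁|) (hc₂ : |tc₂ - xc₂| ≤ u * |xc₂|)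
    (hP₁ : |xb₁ * xc₂ - P₁| ≤ u * |P₁|) (hP₂ : |xc₁ * xb₂ - P₂| ≤ u * |P₂|)
    (hP₃ : |xc₁ * xa₂ - P₃| ≤ u * |P₃|) (hP₄ : |xa₁ * xc₂ - P₄| ≤ u * |P₄|)
    (hP₅ : |xa₁ * xb₂ - P₅| ≤ u * |P₅|) (hP₆ : |xb₁ * xa₂ - P₆| ≤ u * |P₆|)
    (hSa₁ : |xa₁ * xa₁ - Sa₁| ≤ u * |Sa₁|) (hSa₂ : |xa₂ * xa₂ - Sa₂| ≤ u * |Sa₂|)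
    (hSb₁ : |xb₁ * xb₁ - Sb₁| ≤ u * |Sb₁|) (hSb₂ : |xb₂ * xb₂ - Sb₂| ≤ u * |Sb₂|)
    (hSc₁ : |xc₁ * xc₁ - Sc₁| ≤ u * |Sc₁|) (hSc₂ : |xc₂ * xc₂ - Sc₂| ≤ u * |Sc₂|)
    (hSa₁0 : 0 ≤ Sa₁) (hSa₂0 : 0 ≤ Sa₂) (hSb₁0 : 0 ≤ Sb₁) (hSb₂0 : 0 ≤ Sb₂)
    (hSc₁0 : 0 ≤ Sc₁) (hSc₂0 : 0 ≤ Sc₂)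
    (hLa : |(Sa₁ + Sa₂) - La| ≤ u * |La|) (hLb : |(Sb₁ + Sb₂) - Lb| ≤ u * |Lb|)
    (hLc : |(Sc₁ + Sc₂) - Lc| ≤ u * |Lc|) (hLa0 : 0 ≤ La) (hLb0 : 0 ≤ Lb) (hLc0 : 0 ≤ Lc)
    (hMa : |(P₁ - P₂) - Ma| ≤ u * |P₁ - P₂|) (hMb : |(P₃ - P₄) - Mb| ≤ u * |P₃ - P₄|)
    (hMc : |(P₅ - P₆) - Mc| ≤ u * |P₅ - P₆|)
    (hQa : |La * Ma - Qa| ≤ u * |La * Ma|) (hQb : |Lb * Mb - Qb| ≤ u * |Lb * Mb|)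
    (hQc : |Lc * Mc - Qc| ≤ u * |Lc * Mc|)
    (hR : |(Qa + Qb) - R| ≤ u * |Qa + Qb|) (hdet : |(R + Qc) - det| ≤ u * |det|)
    (hAa : |(|P₁| + |P₂|) - Aa| ≤ u * |(|P₁| + |P₂|)|)
    (hAb : |(|P₃| + |P₄|) - Ab| ≤ u * |(|P₃| + |P₄|)|)
    (hAc : |(|P₅| + |P₆|) - Ac| ≤ u * |(|P₅| + |P₆|)|)
    (hαa : |Aa * La - αa| ≤ u * |Aa * La|) (hαb : |Ab * Lb - αb| ≤ u * |Ab * Lb|)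
    (hαc : |Ac * Lc - αc| ≤ u * |Ac * Lc|)
    (hW₁ : |(αa + αb) - W₁| ≤ u * |αa + αb|) (hW : |(W₁ + αc) - W| ≤ u * |W₁ + αc|)
    (hE : |K * W - E| ≤ u * |K * W|) (htest : E < |det|) :
    (0 < det ↔ 0 < (ta₁ * ta₁ + ta₂ * ta₂) * (tb₁ * tc₂ - tc₁ * tb₂)
        + (tb₁ * tb₁ + tb₂ * tb₂) * (tc₁ * ta₂ - ta₁ * tc₂)
        + (tc₁ * tc₁ + tc₂ * tc₂) * (ta₁ * tb₂ - tb₁ * ta₂)) ∧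
      (det < 0 ↔ (ta₁ * ta₁ + ta₂ * ta₂) * (tb₁ * tc₂ - tc₁ * tb₂)
        + (tb₁ * tb₁ + tb₂ * tb₂) * (tc₁ * ta₂ - ta₁ * tc₂)
        + (tc₁ * tc₁ + tc₂ * tc₂) * (ta₁ * tb₂ - tb₁ * ta₂) < 0) := by
  -- the three lifts
  have hv0 : (0 : ℚ) ≤ 4 * u + 6 * u ^ 2 + 4 * u ^ 3 + u ^ 4 := by positivity
  have la : |(ta₁ * ta₁ + ta₂ * ta₂) - La| ≤ (4 * u + 6 * u ^ 2 + 4 * u ^ 3 + u ^ 4) * |La| :=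
    lift_sub_le_of_rel hu0.le ha₁ ha₂ hSa₁ hSa₂ hSa₁0 hSa₂0 hLa hLa0
  have lb : |(tb₁ * tb₁ + tb₂ * tb₂) - Lb| ≤ (4 * u + 6 * u ^ 2 + 4 * u ^ 3 + u ^ 4) * |Lb| :=
    lift_sub_le_of_rel hu0.le hb₁ hb₂ hSb₁ hSb₂ hSb₁0 hSb₂0 hLb hLb0
  have lc : |(tc₁ * tc₁ + tc₂ * tc₂) - Lc| ≤ (4 * u + 6 * u ^ 2 + 4 * u ^ 3 + u ^ 4) * |Lc| :=
    lift_sub_le_of_rel hu0.le hc₁ hc₂ hSc₁ hSc₂ hSc₁0 hSc₂0 hLc hLc0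
  -- the three cofactor terms
  obtain ⟨ea, qa⟩ := liftedCofactor_sub_le_of_rel hu0.le hv0 la hb₁ hc₂ hc₁ hb₂ hP₁ hP₂ hMa hQa
  obtain ⟨eb, qb⟩ := liftedCofactor_sub_le_of_rel hu0.le hv0 lb hc₁ ha₂ ha₁ hc₂ hP₃ hP₄ hMb hQb
  obtain ⟨ec, qc⟩ := liftedCofactor_sub_le_of_rel hu0.le hv0 lc ha₁ hb₂ hb₁ ha₂ hP₅ hP₆ hMc hQc
  rw [abs_of_nonneg hLa0] at ea qa
  rw [abs_of_nonneg hLb0] at eb qb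
  rw [abs_of_nonneg hLc0] at ec qc
  set D := (ta₁ * ta₁ + ta₂ * ta₂) * (tb₁ * tc₂ - tc₁ * tb₂)
    + (tb₁ * tb₁ + tb₂ * tb₂) * (tc₁ * ta₂ - ta₁ * tc₂)
    + (tc₁ * tc₁ + tc₂ * tc₂) * (ta₁ * tb₂ - tb₁ * ta₂) with hD
  set g := (4 * u + 6 * u ^ 2 + 4 * u ^ 3 + u ^ 4) * (1 + 3 * u + 3 * u ^ 2 + u ^ 3)
    + 5 * u + 4 * u ^ 2 + u ^ 3 with hg
  set Sa := |P₁| + |P₂| with hSa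
  set Sb := |P₃| + |P₄| with hSb
  set Sc := |P₅| + |P₆| with hSc
  have hSa0 : 0 ≤ Sa := by rw [hSa]; positivity
  have hSb0 : 0 ≤ Sb := by rw [hSb]; positivity
  have hSc0 : 0 ≤ Sc := by rw [hSc]; positivity
  have hπa0 : 0 ≤ La * Sa := mul_nonneg hLa0 hSa0
  have hπb0 : 0 ≤ Lb * Sb := mul_nonneg hLb0 hSb0
  have hπc0 : 0 ≤ Lc * Sc := mul_nonneg hLc0 hSc0
  have h1u : 0 ≤ 1 - u := by linarith
  have h1u' : 0 < 1 - u := by linarith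
  have hK0 : 0 ≤ K := le_trans (by positivity) hK
  -- the total error `|D − det| ≤ (g + ε(1+ε)²)Π + ε|det|`
  have hR' : |(Qa + Qb) - R| ≤ u * (1 + u) ^ 2 * (La * Sa + Lb * Sb) := by
    calc |(Qa + Qb) - R| ≤ u * |Qa + Qb| := hR
      _ ≤ u * (|Qa| + |Qb|) := mul_le_mul_of_nonneg_left (abs_add_le _ _) hu0.le
      _ ≤ u * ((1 + u) ^ 2 * (La * Sa) + (1 + u) ^ 2 * (Lb * Sb)) :=
          mul_le_mul_of_nonneg_left (add_le_add qa qb) hu0.le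
      _ = u * (1 + u) ^ 2 * (La * Sa + Lb * Sb) := by ring
  have herr : |D - det| ≤ (g + u * (1 + u) ^ 2) * (La * Sa + Lb * Sb + Lc * Sc)
      + u * |det| := by
    have hdec : D - det = (((ta₁ * ta₁ + ta₂ * ta₂) * (tb₁ * tc₂ - tc₁ * tb₂) - Qa)
        + ((tb₁ * tb₁ + tb₂ * tb₂) * (tc₁ * ta₂ - ta₁ * tc₂) - Qb)
        + ((tc₁ * tc₁ + tc₂ * tc₂) * (ta₁ * tb₂ - tb₁ * ta₂) - Qc))
        + (((Qa + Qb) - R) + ((R + Qc) - det)) := by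
      rw [hD]; ring
    rw [hdec]
    have h3 := abs_add_three ((ta₁ * ta₁ + ta₂ * ta₂) * (tb₁ * tc₂ - tc₁ * tb₂) - Qa)
      ((tb₁ * tb₁ + tb₂ * tb₂) * (tc₁ * ta₂ - ta₁ * tc₂) - Qb)
      ((tc₁ * tc₁ + tc₂ * tc₂) * (ta₁ * tb₂ - tb₁ * ta₂) - Qc)
    have h2 := abs_add_le ((Qa + Qb) - R) ((R + Qc) - det)
    have h1 := abs_add_le (((ta₁ * ta₁ + ta₂ * ta₂) * (tb₁ * tc₂ - tc₁ * tb₂) - Qa)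
      + ((tb₁ * tb₁ + tb₂ * tb₂) * (tc₁ * ta₂ - ta₁ * tc₂) - Qb)
      + ((tc₁ * tc₁ + tc₂ * tc₂) * (ta₁ * tb₂ - tb₁ * ta₂) - Qc))
      (((Qa + Qb) - R) + ((R + Qc) - det))
    have hu3 : u * (1 + u) ^ 2 * (La * Sa + Lb * Sb)
        ≤ u * (1 + u) ^ 2 * (La * Sa + Lb * Sb + Lc * Sc) :=
      mul_le_mul_of_nonneg_left (by linarith) (by positivity)
    have hsum : g * (La * Sa) + g * (Lb * Sb) + g * (Lc * Sc)
        + u * (1 + u) ^ 2 * (La * Sa + Lb * Sb + Lc * Sc)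
        = (g + u * (1 + u) ^ 2) * (La * Sa + Lb * Sb + Lc * Sc) := by ring
    linarith
  -- the computed bound: `E ≥ (1 − ε)⁵ K Π`
  have hAa1 : (1 - u) * Sa ≤ Aa := by
    have h := (abs_sub_le_iff.mp hAa).1
    rw [abs_of_nonneg hSa0] at h
    linarith
  have hAb1 : (1 - u) * Sb ≤ Ab := by
    have h := (abs_sub_le_iff.mp hAb).1
    rw [abs_of_nonneg hSb0] at h
    linarith
  have hAc1 : (1 - u) * Sc ≤ Ac := by
    have h := (abs_sub_le_iff.mp hAc).1
    rw [abs_of_nonneg hSc0] at h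
    linarith
  have hAa0 : 0 ≤ Aa := le_trans (mul_nonneg h1u hSa0) hAa1
  have hAb0 : 0 ≤ Ab := le_trans (mul_nonneg h1u hSb0) hAb1
  have hAc0 : 0 ≤ Ac := le_trans (mul_nonneg h1u hSc0) hAc1
  have hαa1 : (1 - u) ^ 2 * (La * Sa) ≤ αa := by
    have h := (abs_sub_le_iff.mp hαa).1
    rw [abs_of_nonneg (mul_nonneg hAa0 hLa0)] at h
    calc (1 - u) ^ 2 * (La * Sa) = (1 - u) * La * ((1 - u) * Sa) := by ring
      _ ≤ (1 - u) * La * Aa := mul_le_mul_of_nonneg_left hAa1 (mul_nonneg h1u hLa0)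
      _ = (1 - u) * (Aa * La) := by ring
      _ ≤ αa := by linarith
  have hαb1 : (1 - u) ^ 2 * (Lb * Sb) ≤ αb := by
    have h := (abs_sub_le_iff.mp hαb).1
    rw [abs_of_nonneg (mul_nonneg hAb0 hLb0)] at h
    calc (1 - u) ^ 2 * (Lb * Sb) = (1 - u) * Lb * ((1 - u) * Sb) := by ring
      _ ≤ (1 - u) * Lb * Ab := mul_le_mul_of_nonneg_left hAb1 (mul_nonneg h1u hLb0)
      _ = (1 - u) * (Ab * Lb) := by ring
      _ ≤ αb := by linarith
  have hαc1 : (1 - u) ^ 2 * (Lc * Sc) ≤ αc := by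
    have h := (abs_sub_le_iff.mp hαc).1
    rw [abs_of_nonneg (mul_nonneg hAc0 hLc0)] at h
    calc (1 - u) ^ 2 * (Lc * Sc) = (1 - u) * Lc * ((1 - u) * Sc) := by ring
      _ ≤ (1 - u) * Lc * Ac := mul_le_mul_of_nonneg_left hAc1 (mul_nonneg h1u hLc0)
      _ = (1 - u) * (Ac * Lc) := by ring
      _ ≤ αc := by linarith
  have h1u2 : 0 ≤ (1 - u) ^ 2 := pow_nonneg h1u 2
  have hαa0 : 0 ≤ αa := le_trans (mul_nonneg h1u2 hπa0) hαa1
  have hαb0 : 0 ≤ αb := le_trans (mul_nonneg h1u2 hπb0) hαb1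
  have hαc0 : 0 ≤ αc := le_trans (mul_nonneg h1u2 hπc0) hαc1
  have hW₁1 : (1 - u) * (αa + αb) ≤ W₁ := by
    have h := (abs_sub_le_iff.mp hW₁).1
    rw [abs_of_nonneg (add_nonneg hαa0 hαb0)] at h
    linarith
  have hW₁0 : 0 ≤ W₁ := le_trans (mul_nonneg h1u (add_nonneg hαa0 hαb0)) hW₁1
  have hW1 : (1 - u) * (W₁ + αc) ≤ W := by
    have h := (abs_sub_le_iff.mp hW).1
    rw [abs_of_nonneg (add_nonneg hW₁0 hαc0)] at h
    linarith
  have hW0 : 0 ≤ W := le_trans (mul_nonneg h1u (add_nonneg hW₁0 hαc0)) hW1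
  have hW2 : (1 - u) ^ 4 * (La * Sa + Lb * Sb + Lc * Sc) ≤ W := by
    have h1 : (1 - u) * ((1 - u) * (αa + αb) + αc) ≤ (1 - u) * (W₁ + αc) :=
      mul_le_mul_of_nonneg_left (by linarith) h1u
    have h2 : (1 - u) ^ 2 * αc ≤ (1 - u) * αc := by
      have h : (1 - u) ^ 2 ≤ 1 - u := by
        have : (1 - u) ^ 2 = (1 - u) - u * (1 - u) := by ring
        rw [this]
        linarith [mul_nonneg hu0.le h1u]
      exact mul_le_mul_of_nonneg_right h hαc0
    have h3 : (1 - u) * ((1 - u) * (αa + αb) + αc) = (1 - u) ^ 2 * (αa + αb) + (1 - u) * αc := by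
      ring
    have h4 : (1 - u) ^ 4 * (La * Sa + Lb * Sb + Lc * Sc)
        = (1 - u) ^ 2 * ((1 - u) ^ 2 * (La * Sa) + (1 - u) ^ 2 * (Lb * Sb)
          + (1 - u) ^ 2 * (Lc * Sc)) := by ring
    have h5 : (1 - u) ^ 2 * ((1 - u) ^ 2 * (La * Sa) + (1 - u) ^ 2 * (Lb * Sb)
          + (1 - u) ^ 2 * (Lc * Sc)) ≤ (1 - u) ^ 2 * (αa + αb + αc) :=
      mul_le_mul_of_nonneg_left (by linarith) h1u2
    have h6 : (1 - u) ^ 2 * (αa + αb + αc) = (1 - u) ^ 2 * (αa + αb) + (1 - u) ^ 2 * αc := by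
      ring
    linarith
  have hE1 : (1 - u) * (K * W) ≤ E := by
    have h := (abs_sub_le_iff.mp hE).1
    rw [abs_of_nonneg (mul_nonneg hK0 hW0)] at h
    linarith
  have hE2 : (1 - u) ^ 5 * K * (La * Sa + Lb * Sb + Lc * Sc) ≤ E := by
    calc (1 - u) ^ 5 * K * (La * Sa + Lb * Sb + Lc * Sc)
          = (1 - u) * (K * ((1 - u) ^ 4 * (La * Sa + Lb * Sb + Lc * Sc))) := by ring
      _ ≤ (1 - u) * (K * W) := mul_le_mul_of_nonneg_left (mul_le_mul_of_nonneg_left hW2 hK0) h1u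
      _ ≤ E := hE1
  -- the margin
  have hPi0 : 0 ≤ La * Sa + Lb * Sb + Lc * Sc := by linarith
  have hG : (g + u * (1 + u) ^ 2) * (La * Sa + Lb * Sb + Lc * Sc)
      ≤ (1 - u) ^ 6 * K * (La * Sa + Lb * Sb + Lc * Sc) := by
    have hm := iccerrboundA_margin hu0.le hu
    have h1 : (1 - u) ^ 6 * ((10 + 96 * u) * u) ≤ (1 - u) ^ 6 * K :=
      mul_le_mul_of_nonneg_left hK (pow_nonneg h1u 6)
    have h2 : g + u * (1 + u) ^ 2 =
        10 * u + 24 * u ^ 2 + 36 * u ^ 3 + 35 * u ^ 4 + 21 * u ^ 5 + 7 * u ^ 6 + u ^ 7 := by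
      rw [hg]; ring
    rw [h2]
    exact mul_le_mul_of_nonneg_right (hm.trans h1) hPi0
  have hmargin : (g + u * (1 + u) ^ 2) * (La * Sa + Lb * Sb + Lc * Sc) < (1 - u) * |det| := by
    calc (g + u * (1 + u) ^ 2) * (La * Sa + Lb * Sb + Lc * Sc)
          ≤ (1 - u) ^ 6 * K * (La * Sa + Lb * Sb + Lc * Sc) := hG
      _ = (1 - u) * ((1 - u) ^ 5 * K * (La * Sa + Lb * Sb + Lc * Sc)) := by ring
      _ ≤ (1 - u) * E := mul_le_mul_of_nonneg_left hE2 h1u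
      _ < (1 - u) * |det| := mul_lt_mul_of_pos_left htest h1u'
  have hstrict : |D - det| < |det| := by linarith
  -- sign conclusions
  obtain ⟨hl, hr⟩ := abs_sub_lt_iff.mp hstrict
  constructor
  · constructor
    · intro hpos
      rw [abs_of_pos hpos] at hr
      linarith
    · intro hDpos
      by_contra hle
      push Not at hle
      rcases hle.lt_or_eq with hneg | hzero
      · rw [abs_of_neg hneg] at hl
        linarith
      · rw [hzero, abs_zero] at hstrict
        exact absurd hstrict (not_lt.mpr (abs_nonneg _))
  · constructor
    · intro hneg
      rw [abs_of_neg hneg] at hl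
      linarith
    · intro hDneg
      by_contra hle
      push Not at hle
      rcases hle.lt_or_eq with hpos | hzero
      · rw [abs_of_pos hpos] at hr
        linarith
      · rw [← hzero, abs_zero] at hstrict
        exact absurd hstrict (not_lt.mpr (abs_nonneg _))


/-! ## Stage A of INCIRCLE -/

/-- The coefficient `iccerrboundA = (10 + 96ε)ε` of Table 5, line A (`ε = 2^−p`; `predicates.c`
`exactinit`: `iccerrboundA = (10.0 + 96.0 * epsilon) * epsilon`, computed exactly).
[cite: Shewchuk1997, §4.4 Table 5 p. 352] -/
def iccerrboundA (p : ℕ) : ℚ := (10 + 96 * unitRoundoff p) * unitRoundoff p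

/-- `iccerrboundA = (10·2^p + 96)·2^(−2p)` lies on the grid `2^(−2p) ℤ`.
[cite: Shewchuk1997, §4.4 Table 5 p. 352] -/
theorem onGrid_iccerrboundA (p : ℕ) : OnGrid (-(2 * (p : ℤ))) (iccerrboundA p) := by
  refine ⟨10 * 2 ^ p + 96, ?_⟩
  unfold iccerrboundA unitRoundoff
  have h2 : (2 : ℚ) ^ p ≠ 0 := pow_ne_zero _ (by norm_num)
  rw [show (-(2 * (p : ℤ))) = -((p : ℤ) + (p : ℤ)) by ring, zpow_neg, zpow_add₀ (by norm_num),
    zpow_natCast]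
  push_cast
  field_simp

/-- The exact incircle determinant ((9), two-dimensional version), expanded along its third
column as `predicates.c` computes it:
`(adx² + ady²)(bdx·cdy − cdx·bdy) + (bdx² + bdy²)(cdx·ady − adx·cdy) + (cdx² + cdy²)(adx·bdy − bdx·ady)`
with `adx = a_x − d_x`, …; positive iff `d` lies inside the oriented circle `abc` (§4.2 p. 344).
[cite: Shewchuk1997, §4.2 p. 344–345, eq. (9); §4.4 p. 352] -/
def incircleDet (a₁ a₂ b₁ b₂ c₁ c₂ d₁ d₂ : ℚ) : ℚ :=
  ((a₁ - d₁) * (a₁ - d₁) + (a₂ - d₂) * (a₂ - d₂)) * ((b₁ - d₁) * (c₂ - d₂) - (c₁ - d₁) * (b₂ - d₂))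
    + ((b₁ - d₁) * (b₁ - d₁) + (b₂ - d₂) * (b₂ - d₂))
      * ((c₁ - d₁) * (a₂ - d₂) - (a₁ - d₁) * (c₂ - d₂))
    + ((c₁ - d₁) * (c₁ - d₁) + (c₂ - d₂) * (c₂ - d₂))
      * ((a₁ - d₁) * (b₂ - d₂) - (b₁ - d₁) * (a₂ - d₂))

/-- `incircleDet` is the `3 × 3` determinant with rows `(a_x − d_x, a_y − d_y, (a_x − d_x)² +
(a_y − d_y)²)`, `(b …)`, `(c …)` (cofactor expansion along the first row).
[cite: Shewchuk1997, §4.2 eq. (9) p. 345 (two-dimensional version)] -/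
theorem incircleDet_eq_det (a₁ a₂ b₁ b₂ c₁ c₂ d₁ d₂ : ℚ) :
    incircleDet a₁ a₂ b₁ b₂ c₁ c₂ d₁ d₂ =
      (a₁ - d₁) * ((b₂ - d₂) * ((c₁ - d₁) ^ 2 + (c₂ - d₂) ^ 2)
          - ((b₁ - d₁) ^ 2 + (b₂ - d₂) ^ 2) * (c₂ - d₂))
        - (a₂ - d₂) * ((b₁ - d₁) * ((c₁ - d₁) ^ 2 + (c₂ - d₂) ^ 2)
          - ((b₁ - d₁) ^ 2 + (b₂ - d₂) ^ 2) * (c₁ - d₁))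
        + ((a₁ - d₁) ^ 2 + (a₂ - d₂) ^ 2) * ((b₁ - d₁) * (c₂ - d₂) - (b₂ - d₂) * (c₁ - d₁)) := by
  unfold incircleDet; ring

/-- **Stage A of INCIRCLE** (`predicates.c` function `incircle`; the ORIENT3D tree of Fig. 22 with
lifts in place of `z`-differences, Table 5), over a rounding `fl` and a bound coefficient `K`:
the six differences `adx = a_x ⊖ d_x, …, cdy = c_y ⊖ d_y`, the six products
`bdxcdy = bdx ⊗ cdy, cdxbdy, cdxady, adxcdy, adxbdy, bdxady`, the three lifts
`alift = adx ⊗ adx ⊕ ady ⊗ ady, blift, clift`,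
`det ⇐ alift ⊗ (bdxcdy ⊖ cdxbdy) ⊕ blift ⊗ (cdxady ⊖ adxcdy) ⊕ clift ⊗ (adxbdy ⊖ bdxady)`,
`permanent ⇐ (|bdxcdy| ⊕ |cdxbdy|) ⊗ alift ⊕ (|cdxady| ⊕ |adxcdy|) ⊗ blift
⊕ (|adxbdy| ⊕ |bdxady|) ⊗ clift` (both three-term sums left to right),
`errbound ⇐ K ⊗ permanent`; return `det` iff `det > errbound` or `−det > errbound`.  `some det` =
stage A answers; `none` = fall through to `incircleadapt`.
[cite: Shewchuk1997, §4.4 p. 352 and Table 5] -/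
def incircleStageA (fl : ℚ → ℚ) (K : ℚ) (a₁ a₂ b₁ b₂ c₁ c₂ d₁ d₂ : ℚ) : Option ℚ :=
  let adx := fl (a₁ - d₁)
  let bdx := fl (b₁ - d₁)
  let cdx := fl (c₁ - d₁)
  let ady := fl (a₂ - d₂)
  let bdy := fl (b₂ - d₂)
  let cdy := fl (c₂ - d₂)
  let bdxcdy := fl (bdx * cdy)
  let cdxbdy := fl (cdx * bdy)
  let alift := fl (fl (adx * adx) + fl (ady * ady))
  let cdxady := fl (cdx * ady)
  let adxcdy := fl (adx * cdy)
  let blift := fl (fl (bdx * bdx) + fl (bdy * bdy))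
  let adxbdy := fl (adx * bdy)
  let bdxady := fl (bdx * ady)
  let clift := fl (fl (cdx * cdx) + fl (cdy * cdy))
  let det := fl (fl (fl (alift * fl (bdxcdy - cdxbdy)) + fl (blift * fl (cdxady - adxcdy)))
    + fl (clift * fl (adxbdy - bdxady)))
  let permanent := fl (fl (fl (fl (|bdxcdy| + |cdxbdy|) * alift)
    + fl (fl (|cdxady| + |adxcdy|) * blift)) + fl (fl (|adxbdy| + |bdxady|) * clift))
  let errbound := fl (K * permanent)
  if errbound < det ∨ errbound < -det then some det else none

/-- **THE STAGE-A FILTER OF INCIRCLE IS CORRECT** (Table 5, line A).  Let `p ≥ 6`, `fl` ANY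
round-to-nearest into `F(p, emin)` (any tie-breaking rule), `K = iccerrboundA p = (10 + 96ε)ε`,
and the eight coordinates floats of a format `F(p, e₀)` with `emin ≤ e₀` and `emin + 2p ≤ 4e₀`
(so that every operation of stage A — on the grids `2^e₀ ℤ`, `2^2e₀ ℤ`, `2^4e₀ ℤ`,
`2^(4e₀ − 2p) ℤ` — is exact or rounds a normal number).  If stage A returns `det`, then
`det > 0 ↔ D > 0` and `det < 0 ↔ D < 0` for the exact determinant `D = incircleDet`; in
particular `det ≠ 0` and the returned sign is the true incircle answer.
[cite: Shewchuk1997, §4.4 Table 5 p. 352 (line A)] -/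
theorem incircleStageA_correct (hp : 6 ≤ p) (hfl : IsRoundNearest p emin fl) {e₀ : ℤ}
    (he₀ : emin ≤ e₀) (h4 : emin + 2 * p ≤ e₀ + e₀ + e₀ + e₀)
    {a₁ a₂ b₁ b₂ c₁ c₂ d₁ d₂ : ℚ}
    (ha₁ : IsFloat p e₀ a₁) (ha₂ : IsFloat p e₀ a₂) (hb₁ : IsFloat p e₀ b₁)
    (hb₂ : IsFloat p e₀ b₂) (hc₁ : IsFloat p e₀ c₁) (hc₂ : IsFloat p e₀ c₂)
    (hd₁ : IsFloat p e₀ d₁) (hd₂ : IsFloat p e₀ d₂) {A : ℚ}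
    (hA : incircleStageA fl (iccerrboundA p) a₁ a₂ b₁ b₂ c₁ c₂ d₁ d₂ = some A) :
    (0 < A ↔ 0 < incircleDet a₁ a₂ b₁ b₂ c₁ c₂ d₁ d₂) ∧
      (A < 0 ↔ incircleDet a₁ a₂ b₁ b₂ c₁ c₂ d₁ d₂ < 0) := by
  have hp1 : 1 ≤ p := le_trans (by norm_num) hp
  have he₂ : emin ≤ e₀ + e₀ := by omega
  have he₄ : emin ≤ e₀ + e₀ + (e₀ + e₀) := by omega
  have he₅ : emin ≤ -(2 * (p : ℤ)) + (e₀ + e₀ + (e₀ + e₀)) := by omega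
  have hu0 : 0 < unitRoundoff p := by unfold unitRoundoff; positivity
  have hu64 : unitRoundoff p ≤ 1 / 64 := by
    unfold unitRoundoff
    have h : (64 : ℚ) ≤ 2 ^ p := by
      calc (64 : ℚ) = 2 ^ 6 := by norm_num
        _ ≤ 2 ^ p := pow_le_pow_right₀ (by norm_num) hp
    exact one_div_le_one_div_of_le (by norm_num) h
  have hK : (10 + 96 * unitRoundoff p) * unitRoundoff p ≤ iccerrboundA p := le_of_eq rfl
  -- grids: the six differences (`2^e₀ ℤ`) and their roundings
  have gta₁ := (OnGrid.of_isFloat ha₁).sub (OnGrid.of_isFloat hd₁)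
  have gta₂ := (OnGrid.of_isFloat ha₂).sub (OnGrid.of_isFloat hd₂)
  have gtb₁ := (OnGrid.of_isFloat hb₁).sub (OnGrid.of_isFloat hd₁)
  have gtb₂ := (OnGrid.of_isFloat hb₂).sub (OnGrid.of_isFloat hd₂)
  have gtc₁ := (OnGrid.of_isFloat hc₁).sub (OnGrid.of_isFloat hd₁)
  have gtc₂ := (OnGrid.of_isFloat hc₂).sub (OnGrid.of_isFloat hd₂)
  have gxa₁ := gta₁.fl_of hp1 hfl he₀
  have gxa₂ := gta₂.fl_of hp1 hfl he₀
  have gxb₁ := gtb₁.fl_of hp1 hfl he₀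
  have gxb₂ := gtb₂.fl_of hp1 hfl he₀
  have gxc₁ := gtc₁.fl_of hp1 hfl he₀
  have gxc₂ := gtc₂.fl_of hp1 hfl he₀
  -- the six products, the six squares and their roundings (`2^2e₀ ℤ`)
  have gp₁ := gxb₁.mul gxc₂
  have gp₂ := gxc₁.mul gxb₂
  have gp₃ := gxc₁.mul gxa₂
  have gp₄ := gxa₁.mul gxc₂
  have gp₅ := gxa₁.mul gxb₂
  have gp₆ := gxb₁.mul gxa₂
  have gP₁ := gp₁.fl_of hp1 hfl he₂
  have gP₂ := gp₂.fl_of hp1 hfl he₂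
  have gP₃ := gp₃.fl_of hp1 hfl he₂
  have gP₄ := gp₄.fl_of hp1 hfl he₂
  have gP₅ := gp₅.fl_of hp1 hfl he₂
  have gP₆ := gp₆.fl_of hp1 hfl he₂
  have gsa₁ := gxa₁.mul gxa₁
  have gsa₂ := gxa₂.mul gxa₂
  have gsb₁ := gxb₁.mul gxb₁
  have gsb₂ := gxb₂.mul gxb₂
  have gsc₁ := gxc₁.mul gxc₁
  have gsc₂ := gxc₂.mul gxc₂
  have gSa₁ := gsa₁.fl_of hp1 hfl he₂
  have gSa₂ := gsa₂.fl_of hp1 hfl he₂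
  have gSb₁ := gsb₁.fl_of hp1 hfl he₂
  have gSb₂ := gsb₂.fl_of hp1 hfl he₂
  have gSc₁ := gsc₁.fl_of hp1 hfl he₂
  have gSc₂ := gsc₂.fl_of hp1 hfl he₂
  -- the lifts (`2^2e₀ ℤ`)
  have gla := gSa₁.add gSa₂
  have glb := gSb₁.add gSb₂
  have glc := gSc₁.add gSc₂
  have gLa := gla.fl_of hp1 hfl he₂
  have gLb := glb.fl_of hp1 hfl he₂
  have gLc := glc.fl_of hp1 hfl he₂
  -- minors (`2^2e₀ ℤ`), cofactor terms and the two additions (`2^4e₀ ℤ`)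
  have gma := gP₁.sub gP₂
  have gmb := gP₃.sub gP₄
  have gmc := gP₅.sub gP₆
  have gMa := gma.fl_of hp1 hfl he₂
  have gMb := gmb.fl_of hp1 hfl he₂
  have gMc := gmc.fl_of hp1 hfl he₂
  have gqa := gLa.mul gMa
  have gqb := gLb.mul gMb
  have gqc := gLc.mul gMc
  have gQa := gqa.fl_of hp1 hfl he₄
  have gQb := gqb.fl_of hp1 hfl he₄
  have gQc := gqc.fl_of hp1 hfl he₄
  have gr := gQa.add gQb
  have gR := gr.fl_of hp1 hfl he₄
  have gd := gR.add gQc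
  -- the bound: `A_a = fl(|P₁| + |P₂|)` (`2^2e₀ ℤ`), `α_a = fl(A_a · alift)`, `W₁`, `W` (`2^4e₀ ℤ`),
  -- `errbound = fl(K W)` (`2^(4e₀ − 2p) ℤ`)
  have gsa := gP₁.abs.add gP₂.abs
  have gsb := gP₃.abs.add gP₄.abs
  have gsc := gP₅.abs.add gP₆.abs
  have gAa := gsa.fl_of hp1 hfl he₂
  have gAb := gsb.fl_of hp1 hfl he₂
  have gAc := gsc.fl_of hp1 hfl he₂
  have gala := gAa.mul gLa
  have galb := gAb.mul gLb
  have galc := gAc.mul gLc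
  have gαa := gala.fl_of hp1 hfl he₄
  have gαb := galb.fl_of hp1 hfl he₄
  have gαc := galc.fl_of hp1 hfl he₄
  have gw₁ := gαa.add gαb
  have gW₁ := gw₁.fl_of hp1 hfl he₄
  have gw := gW₁.add gαc
  have gW := gw.fl_of hp1 hfl he₄
  have ge := (onGrid_iccerrboundA p).mul gW
  -- signs of the squares and lifts
  have sSa₁ : 0 ≤ fl (fl (a₁ - d₁) * fl (a₁ - d₁)) := fl_nonneg hfl (mul_self_nonneg _)
  have sSa₂ : 0 ≤ fl (fl (a₂ - d₂) * fl (a₂ - d₂)) := fl_nonneg hfl (mul_self_nonneg _)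
  have sSb₁ : 0 ≤ fl (fl (b₁ - d₁) * fl (b₁ - d₁)) := fl_nonneg hfl (mul_self_nonneg _)
  have sSb₂ : 0 ≤ fl (fl (b₂ - d₂) * fl (b₂ - d₂)) := fl_nonneg hfl (mul_self_nonneg _)
  have sSc₁ : 0 ≤ fl (fl (c₁ - d₁) * fl (c₁ - d₁)) := fl_nonneg hfl (mul_self_nonneg _)
  have sSc₂ : 0 ≤ fl (fl (c₂ - d₂) * fl (c₂ - d₂)) := fl_nonneg hfl (mul_self_nonneg _)
  have sLa := fl_nonneg hfl (add_nonneg sSa₁ sSa₂)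
  have sLb := fl_nonneg hfl (add_nonneg sSb₁ sSb₂)
  have sLc := fl_nonneg hfl (add_nonneg sSc₁ sSc₂)
  -- the branches of stage A
  unfold incircleStageA at hA
  simp only [] at hA
  split_ifs at hA with htest
  obtain rfl := Option.some.inj hA
  unfold incircleDet
  exact incircle_stageA_sign_of_bounds hu0 hu64 hK
    (abs_sub_fl_le_eps_mul_abs_fl hp1 hfl he₀ gta₁) (abs_sub_fl_le_eps_mul_abs_fl hp1 hfl he₀ gta₂)
    (abs_sub_fl_le_eps_mul_abs_fl hp1 hfl he₀ gtb₁) (abs_sub_fl_le_eps_mul_abs_fl hp1 hfl he₀ gtb₂)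
    (abs_sub_fl_le_eps_mul_abs_fl hp1 hfl he₀ gtc₁) (abs_sub_fl_le_eps_mul_abs_fl hp1 hfl he₀ gtc₂)
    (abs_sub_fl_le_eps_mul_abs_fl hp1 hfl he₂ gp₁) (abs_sub_fl_le_eps_mul_abs_fl hp1 hfl he₂ gp₂)
    (abs_sub_fl_le_eps_mul_abs_fl hp1 hfl he₂ gp₃) (abs_sub_fl_le_eps_mul_abs_fl hp1 hfl he₂ gp₄)
    (abs_sub_fl_le_eps_mul_abs_fl hp1 hfl he₂ gp₅) (abs_sub_fl_le_eps_mul_abs_fl hp1 hfl he₂ gp₆)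
    (abs_sub_fl_le_eps_mul_abs_fl hp1 hfl he₂ gsa₁) (abs_sub_fl_le_eps_mul_abs_fl hp1 hfl he₂ gsa₂)
    (abs_sub_fl_le_eps_mul_abs_fl hp1 hfl he₂ gsb₁) (abs_sub_fl_le_eps_mul_abs_fl hp1 hfl he₂ gsb₂)
    (abs_sub_fl_le_eps_mul_abs_fl hp1 hfl he₂ gsc₁) (abs_sub_fl_le_eps_mul_abs_fl hp1 hfl he₂ gsc₂)
    sSa₁ sSa₂ sSb₁ sSb₂ sSc₁ sSc₂
    (abs_sub_fl_le_eps_mul_abs_fl hp1 hfl he₂ gla) (abs_sub_fl_le_eps_mul_abs_fl hp1 hfl he₂ glb)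
    (abs_sub_fl_le_eps_mul_abs_fl hp1 hfl he₂ glc) sLa sLb sLc
    (abs_sub_fl_le_eps_mul_abs hp1 hfl he₂ gma) (abs_sub_fl_le_eps_mul_abs hp1 hfl he₂ gmb)
    (abs_sub_fl_le_eps_mul_abs hp1 hfl he₂ gmc)
    (abs_sub_fl_le_eps_mul_abs hp1 hfl he₄ gqa) (abs_sub_fl_le_eps_mul_abs hp1 hfl he₄ gqb)
    (abs_sub_fl_le_eps_mul_abs hp1 hfl he₄ gqc)
    (abs_sub_fl_le_eps_mul_abs hp1 hfl he₄ gr) (abs_sub_fl_le_eps_mul_abs_fl hp1 hfl he₄ gd)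
    (abs_sub_fl_le_eps_mul_abs hp1 hfl he₂ gsa) (abs_sub_fl_le_eps_mul_abs hp1 hfl he₂ gsb)
    (abs_sub_fl_le_eps_mul_abs hp1 hfl he₂ gsc)
    (abs_sub_fl_le_eps_mul_abs hp1 hfl he₄ gala) (abs_sub_fl_le_eps_mul_abs hp1 hfl he₄ galb)
    (abs_sub_fl_le_eps_mul_abs hp1 hfl he₄ galc)
    (abs_sub_fl_le_eps_mul_abs hp1 hfl he₄ gw₁) (abs_sub_fl_le_eps_mul_abs hp1 hfl he₄ gw)
    (abs_sub_fl_le_eps_mul_abs hp1 hfl he₅ ge)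
    (htest.elim (fun h => lt_of_lt_of_le h (le_abs_self _))
      (fun h => lt_of_lt_of_le h (neg_le_abs _)))

end Literature.ComputerArithmetic.Shewchuk1997
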